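import Literature.MathematicalPhysics.QuantumFieldTheory.Balaban1983to89.B6Prop22MultiLevelTorusL0
import Literature.MathematicalPhysics.QuantumFieldTheory.Balaban1983to89.B8Ineq192MultiLevelTorusL0
import Literature.MathematicalPhysics.QuantumFieldTheory.Balaban1983to89.B6Geom246MultiLevelBoxL0
import Literature.MathematicalPhysics.QuantumFieldTheory.Balaban1983to89.B6Geom246MultiLevelTorusL0
import Literature.MathematicalPhysics.QuantumFieldTheory.Balaban1983to89.B6Ineq268MultiLevelBoxL0
import Literature.MathematicalPhysics.QuantumFieldTheory.Balaban1983to89.B6MultiLevelBoxOperatorL0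
import Literature.MathematicalPhysics.QuantumFieldTheory.Balaban1983to89.B6MultiLevelTorusOperatorL0
/-!
# `Balaban1983to89.B6Ineq268MultiLevelTorusL0` — LEVEL-0 TWIN (programme G-F3′-L0, director-ym LINE №27 / UV3-NODE §24.5; plan `lit-balaban-r03/G-F3L0-PLAN.md`) of `B6Ineq268MultiLevelTorus`:
the same declarations, SAME NAMES AND STATEMENTS, for nested families WITH print's region `Λ₀ = T ∖ Ω₁` ADMITTED (structures
`B6MultiLevelBoxOperatorL0.Domains` / `B6MultiLevelTorusOperatorL0.TDomains`: levels `0, …, k`, the level-`0` block a single site, `Q′₀ = id`,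
finite weight `a₀` — print p.225 (2.14) «Σ_{j=0}^k … (Q′₀λ)(x) = λ(x), x ∈ Λ₀», p.229 «taking a sequence (2.1) … smallest possible domains B^j(Λ_j),
and considering the operator Δ_a defined by (2.19), (2.20) for this sequence»).  Every `D`-free object is the lineage's, consumed BY NAME; no existing
module is touched; no fact is minted.  Unit `lit-balaban-r03` (B6 fold owner, r03 gen 36); referee ref-4.  THE TWIN'S DOCUMENTATION FOLLOWS
VERBATIM (its «levels 1 … k» / «Ω₁ = X» sentences describe the twin; here `j` runs from `0` and `Ω₁` may be a proper subset).

# `Balaban1983to89.B6Ineq268MultiLevelTorus` — [B6] (2.68)–(2.69) FOR THE GENUINE `k`-LEVEL OPERATOR ON THE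
TORUS `T_η`: the (2.69)-kernel `X(y, y′)` of `Q′G′²Q′*` for `G′ = Δ′_a⁻¹` of an ARBITRARY nested family (2.1)–(2.2) on
print's carrier `T_η` (`Ω₁ = T_η`) satisfies `|(Q′G′²Q′*)(y, y′)| ≤ O(1)(L^jη)⁴(L^{j′}η)^{−d}e^{−¼δ₀d_T(y,y′)}` uniformly
in `k` — the torus twin of `B6Ineq268MultiLevelBox` (file 1 of the torus `(Q′G′²Q′*)⁻¹` programme of seat p21; no
existing module is touched; no fact is minted)

FRAMING (verbatim cell line):
statement-level skeleton of published theorems with citation tags; proofs where landed; nothing here is a claim about the Yang–Mills mass gap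

Source under audit (cell pub-balaban / lit-balaban): T. Bałaban, *Propagators and renormalization transformations for
lattice gauge theories. II*, Commun. Math. Phys. **96** (1984) 223–250 [`Balaban1984PropagatorsII`, "B6"], p. 235 [PDF 13]
(2.68)–(2.69) (held text `paper:balaban1984-cmp96-propagators-rt-ii` p0013, re-read this generation), p. 224 [PDF 2]
(«we admit the case when some domains Ω_j are equal to T_η»).  Unit `lit-balaban-p21` (Phase-2 proof seat p21 gen 16),
HOME `run/shared/lean/pub/lit-balaban/`, free-target protocol G.5-34(d) (B6-CLOSURE item 7 (d2) of the fold owner r03),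
referee ref-4.

## WHAT IS PRINTED (p. 235, verbatim up to notation)

«Let us consider now the operator Q′G′²Q′* and its inverse (Q′G′²Q′*)⁻¹. The inequalities (2.67) imply
|(Q′G′²Q′*)(y, y′)| = |Σ_{y″∈𝔅}(Q′G′Δ(y″)G′Q′*)(y, y′)| ≤ Σ_{y″∈𝔅} O(1)(L^jη)²e^{−½δ₀d(y,y″)}(L^{j″}η)²(L^{j′}η)^{−d}
e^{−½δ₀d(y″,y′)} ≤ … ≤ O(1)(L^jη)⁴(L^{j′}η)^{−d}e^{−¼δ₀d(y,y′)}, (2.68) where we have used the inequalities (2.60), (2.63)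
of Lemma 1. … ⟨λ, λ′⟩ = Σ_{j=0}^{k}Σ_{y∈Λ_j}(L^jη)^dλ(y)λ′(y). (2.69)»

## WHAT THIS FILE CERTIFIES (kernel-checked; setting of `B6MultiLevelTorusOperator` / `B6Geom246MultiLevelTorus`)

For every nested family `D : TDomains d ℓ M_h k P R` ON THE TORUS (levels `1 … k`, `Ω₁ = T_η`, fundamental box
`Π_μ[0, L^k·L·M_h·P_μ)`, lattice units, spatial dimension `d + 1`), windowed weights `a_{i+1} = aNext ℓ a_i c_i`, the
GENUINE torus operator `G′ = gmlT = Δ′_a⁻¹` and the (2.69)-kernel `X = XkT` of `Q′G′²Q′*` (r05's `B8Ineq192MultiLevelTorus`,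
whose torus chain geometry `geomTB D` = `geomT D` with print's `M = L·M_h`, `R·M = R·L·M_h − 1` is used BY NAME):
**`ineq268_multiLevelTorus`** — there are `δ₀, C, M₀, N₀ > 0` (functions of `d, L` and the weight window) such that for
every `k`, `M_h ≥ 3` with `L·M_h ≥ M₀`, `R ≥ 2L` with `R·L·M_h ≥ N₀ + 1`, every `P` with `P_μ ≥ 4`, every torus family `D`
and every windowed weight sequence, `|X(y, y′)| ≤ C·(L^j)⁴·((L^{j′})^{d+1})⁻¹·e^{−¼δ₀d_T(y,y′)}` AND the weighted form
`|(L^{j′})^{d+1}X(y, y′)| ≤ C·(L^j)⁴·e^{−½(½δ₀)d_T(y,y′)}`, `d_T` = the torus distance (2.46) (`geomT`), `δ₀` = the rate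
of the torus (2.67)₁ `B6Prop22MultiLevelTorusL0.prop22_first_multiLevelTorus` — print's passage `½δ₀ ↦ ¼δ₀`.  Proof =
print's: p01's kernel-checked `B6Ineq268From267.ineq268_of_267` ((2.67)₁ twice around `Σ_{y″}Δ(y″) = I`, (2.54),
(2.60), (2.61) at `α = ¼`, threshold `L² ≤ e^{¼δ₀(RM−1)}`) fed with the torus inputs: (2.67)₁ on `T_η`, Lemma 2.1 on
the torus `B6Geom246MultiLevelTorusL0.lemma21_torus` (α = ¼), (2.60) on the torus `levelSepTB`.

## HONEST SCOPE

* Print's carrier `T_η` with `Ω₁ = T_η` (levels `1 … k`; print's level `0` is empty in this admitted case), `A = 0`,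
  `m² = 0`, lattice units, `P_μ ≥ 4` (the charts of the torus (2.67)₁) — exactly the scope of the torus Prop. 2.2 chain
  (`B6MultiLevelTorusOperator` … `B6Prop22KLevelTorusCensusEta`).
* The O(1) of (2.68) is `C²·L²·c + 1`, `c = K261 N₁ (d+1) L 1 (¼δ₀)` the (2.61)-constant of the torus (the same closed
  form as on the box; L-dependent, `k`-uniform); «M sufficiently large» / «RM sufficiently large» are the explicit
  thresholds `M₀`, `N₀`.
* Nothing is inferred from the manuscript: every step is kernel-checked; the quoted sentences locate the statements.
-/

namespace Literature.MathematicalPhysics.QuantumFieldTheory.Balaban1983to89.B6Ineq268MultiLevelTorusL0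

open Finset Matrix
open Literature.MathematicalPhysics.QuantumFieldTheory.Balaban1983to89.B4Reflection242 (boxDom)
open Literature.MathematicalPhysics.QuantumFieldTheory.Balaban1983to89.B6MultiLevelBoxOperator hiding Domains mlOp_apply
open Literature.MathematicalPhysics.QuantumFieldTheory.Balaban1983to89.B6MultiLevelBoxOperatorL0
open Literature.MathematicalPhysics.QuantumFieldTheory.Balaban1983to89.B6MultiLevelTorusOperator hiding TDomains mlOpT_apply mlOpT_eq_reindex_chart mlOpT_mul_reindex mlOpT_tshift
open Literature.MathematicalPhysics.QuantumFieldTheory.Balaban1983to89.B6MultiLevelTorusOperatorL0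
open Literature.MathematicalPhysics.QuantumFieldTheory.Balaban1983to89.B6Geom246MultiLevelBox hiding Touch blkOf blkOf_corner blkOf_eq_iff_blk blkOf_eq_of_blk_i_eq blkOf_val bond bond_adj bset cen connected coord_bounds corner corner_mem csys dist_blkOf_le_box dist_blkOf_le_coord dist_blkOf_le_line dist_cen_le_of_adj dist_cen_le_of_touch dist_le_one_of_near dist_toR_cen_le exists_blkOf_eq geom lemma21_box lev_corner lev_eq_of_blkOf_eq levelGap pack reachable_blkOf reachable_of_near realizes scale_bounds touch_symm triangle_refl_nonneg walk_disp
open Literature.MathematicalPhysics.QuantumFieldTheory.Balaban1983to89.B6Geom246MultiLevelBoxL0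
open Literature.MathematicalPhysics.QuantumFieldTheory.Balaban1983to89.B6Geom246MultiLevelTorus hiding TouchT blkHom blkMap blkMap_blkOf blkMap_injective blkMap_surjective blkOf_tshift_eq bondT bondT_adj bond_le_bondT connectedT csysT distT_le_dist_box distT_le_dist_chart dist_posT_le_of_adj dist_posT_le_of_touchT dist_site_posT_le geomT label_bounds lemma21_torus levelGapT packT posT realizesT touchT_symm triangle_refl_nonneg_T walk_dispT
open Literature.MathematicalPhysics.QuantumFieldTheory.Balaban1983to89.B6Geom246MultiLevelTorusL0
open Literature.MathematicalPhysics.QuantumFieldTheory.Balaban1983to89.B6Ineq268MultiLevelBoxL0 (W W_pos W_eq qB QB QsB qB_ne_zero sum_abs_qB_le)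
open Literature.MathematicalPhysics.QuantumFieldTheory.Balaban1983to89.B8Ineq192MultiLevelTorusL0 (geomTB geomTB_dist geomTB_len geomT_len geomTB_L geomTB_eta geomTB_M geomTB_R geomTB_RM geomTB_RM_nonneg triangleTB symmTB levelSepTB XkT lenT_pos lenT_eq)
open Literature.MathematicalPhysics.QuantumFieldTheory.Balaban1983to89.B6Prop22MultiLevelTorusL0 (prop22_first_multiLevelTorus)
open Literature.MathematicalPhysics.QuantumFieldTheory.Balaban1983to89.B6RandomWalk (HasMajorant BlockSupp)
open Literature.MathematicalPhysics.QuantumFieldTheory.Balaban1983to89.B6Ineq261LevelGap (K261 K261_nonneg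
  theta_lt_one_of_log)
open Literature.MathematicalPhysics.QuantumFieldTheory.Balaban1983to89.B6Ineq2142 (avgOp avgAdj kernelW)
open Literature.MathematicalPhysics.QuantumFieldTheory.Balaban1983to89.B6Ineq243TwoLevelBox (aNext)
open Literature.MathematicalPhysics.QuantumFieldTheory.Balaban1983to89.B6Lemma21Repaired (Ineq261With)

noncomputable section

variable {d : ℕ}

/-! ## §1 Dictionary: the block-average normalisation and the (2.69) weight on the torus geometry -/

section Dict

variable {ℓ Mh k R : ℕ} {P : Fin (d + 1) → ℕ} (D : TDomains d ℓ Mh k P R)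

/-- the volume normalisation of `Q′` read on the torus chain geometry: `|q(y, x)| ≤ 1·1/(L^jη)^{d+1}`.
[cite: Balaban1984PropagatorsII, (2.14) p.225, (2.69) p.235, dictionary] -/
theorem abs_qB_le_T (y : ↥(B6Geom246MultiLevelBoxL0.bset D.toDomains)) (x : ↥(boxDom (N0 ℓ Mh k P))) :
    |qB D.toDomains y x| ≤ 1 * 1 / (geomTB D).len y ^ (d + 1) := by
  rw [geomTB_len, mul_one, mul_one, ← W_eq, B6Ineq268MultiLevelBoxL0.abs_qB, one_div]
  split_ifs
  · exact le_rfl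
  · exact inv_nonneg.2 (W_pos D.toDomains y).le

/-- the (2.69) weight `(L^jη)^{d+1}` of the torus chain geometry IS `W` (as functions on `𝔅`).
[cite: Balaban1984PropagatorsII, (2.69) p.235, dictionary] -/
theorem lenTB_pow_eq_W : (fun z : (B8Ineq192MultiLevelTorusL0.geomTB D).Site => (geomTB D).len z ^ (d + 1)) = W D.toDomains := by
  funext z
  rw [W_eq, geomTB_len, mul_one]

end Dict

/-! ## §2 (2.68) for the genuine `k`-level operator on the torus -/

section Ineq268

/-- **[B6] (2.68) FOR THE GENUINE `k`-LEVEL OPERATOR `G′ = Δ′_a⁻¹` ON THE TORUS `T_η`.**  There are `δ₀, C, M₀, N₀ > 0`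
(functions of `d`, `L` and the weight window) such that for every `k`, `M_h ≥ 3` with `M = L·M_h ≥ M₀`, `R ≥ 2L` with
`R·M ≥ N₀ + 1`, every `P` with `P_μ ≥ 4`, every nested family `D` on the torus satisfying (2.1)–(2.2) and every windowed
weight sequence with `a_{i+1} = aNext ℓ a_i c_i`, the (2.69)-kernel `X = XkT` of `Q′G′²Q′*` obeys, for all `y ∈ Λ_j`,
`y′ ∈ Λ_{j′}`: `|X(y, y′)| ≤ C·(L^j)⁴·((L^{j′})^{d+1})⁻¹·e^{−¼δ₀d_T(y,y′)}`
(«|(Q′G′²Q′*)(y, y′)| ≤ O(1)(L^jη)⁴(L^{j′}η)^{−d}e^{−¼δ₀d(y,y′)}») and, equivalently,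
`|(L^{j′})^{d+1}·X(y, y′)| ≤ C·(L^j)⁴·e^{−½(½δ₀)d_T(y,y′)}`; here `d_T` is print's distance (2.46) on the torus and `δ₀`
the rate of the torus (2.67)₁ `prop22_first_multiLevelTorus` (majorant `e^{−½δ₀d_T}`), so the rate is halved exactly as
printed.  Route = the print's, by `B6Ineq268From267.ineq268_of_267` on the torus (2.67)₁, `lemma21_torus` (α = ¼) and
`levelSepTB` (2.60). [cite: Balaban1984PropagatorsII, (2.68) p.235; Prop. 2.2 (2.67) p.234; Lemma 2.1 (2.60)–(2.61) p.234; p.224 (Ω_j = T_η admitted)] -/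
theorem ineq268_multiLevelTorus (d ℓ : ℕ) (hℓ : 1 ≤ ℓ) (aminus aplus a2minus a2plus : ℝ) (ha : 0 < aminus)
    (ha2 : 0 < a2minus) :
    ∃ δ₀ C M₀ : ℝ, ∃ N₀ : ℕ, 0 < δ₀ ∧ 0 < C ∧ 0 < M₀ ∧ 0 < N₀ ∧
      ∀ (k Mh R : ℕ), 3 ≤ Mh → M₀ ≤ ((ℓ : ℝ) + 1) * Mh → 2 * (ℓ + 1) ≤ R → N₀ + 1 ≤ R * ((ℓ + 1) * Mh) →
      ∀ (P : Fin (d + 1) → ℕ) (_hP : ∀ μ, 1 ≤ P μ) (_hP4 : ∀ μ, 4 ≤ P μ) (D : TDomains d ℓ Mh k P R) (a c : ℕ → ℝ),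
        (∀ i, aminus ≤ a i ∧ a i ≤ aplus) → (∀ i, a2minus ≤ c i ∧ c i ≤ a2plus) →
        (∀ i, a (i + 1) = aNext ℓ (a i) (c i)) →
        ∀ y y' : ↥(bset D.toDomains),
          |XkT D a y y'| ≤ C * ((geomT D).len y) ^ 4 * (((geomT D).len y') ^ (d + 1))⁻¹ *
              Real.exp (-(δ₀ / 4 * (geomT D).dist y y')) ∧
          |(geomT D).len y' ^ (d + 1) * XkT D a y y'| ≤
            C * ((geomT D).len y) ^ 4 * Real.exp (-(1 / 2 * (δ₀ / 2) * (geomT D).dist y y')) := by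
  obtain ⟨δ₀, C, M₀, N₀, hδ₀, hC, hM₀, hN₀, hmaj⟩ :=
    prop22_first_multiLevelTorus d ℓ hℓ aminus aplus a2minus a2plus ha ha2
  have hL0 : (0 : ℝ) < (ℓ : ℝ) + 1 := by positivity
  have hL1 : (1 : ℝ) ≤ (ℓ : ℝ) + 1 := by linarith [(Nat.cast_nonneg ℓ : (0 : ℝ) ≤ ℓ)]
  -- the (2.59)-type threshold for Lemma 2.1 at `α = ¼` and for `L² ≤ e^{¼δ₀(RM − 1)}`
  obtain ⟨N₁, hN₁⟩ : ∃ N₁ : ℕ, N₁ = ⌈32 * ((d : ℝ) + 1) * ((ℓ : ℝ) + 1) / δ₀⌉₊ + 1 := ⟨_, rfl⟩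
  have hN₁pos : 0 < N₁ := by rw [hN₁]; omega
  have hN₁ge : 32 * ((d : ℝ) + 1) * ((ℓ : ℝ) + 1) / δ₀ < (N₁ : ℝ) := by
    rw [hN₁]; push_cast
    exact lt_of_le_of_lt (Nat.le_ceil _) (by linarith)
  have hN₁ge' : 32 * ((d : ℝ) + 1) * ((ℓ : ℝ) + 1) < δ₀ * (N₁ : ℝ) := by
    rw [div_lt_iff₀ hδ₀] at hN₁ge; linarith
  have hlog : Real.log ((ℓ : ℝ) + 1) ≤ (ℓ : ℝ) + 1 := (Real.log_le_sub_one_of_pos hL0).trans (by linarith)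
  have hlog0 : 0 ≤ Real.log ((ℓ : ℝ) + 1) := Real.log_nonneg hL1
  have hθlt : Real.exp (-(1 / 4 * δ₀)) * ((ℓ : ℝ) + 1) ^ ((2 * (d + 1 : ℕ) : ℝ) / N₁) < 1 := by
    refine theta_lt_one_of_log hL0 hN₁pos ?_
    push_cast
    have hd0 : (0 : ℝ) ≤ 2 * ((d : ℝ) + 1) := by positivity
    nlinarith [mul_le_mul_of_nonneg_left hlog hd0]
  -- the (2.61)-constant at `α = ¼` and the O(1) of (2.68)
  obtain ⟨cK, hcK⟩ : ∃ cK : ℝ, cK = K261 N₁ (d + 1) ((ℓ : ℝ) + 1) 1 (1 / 4 * δ₀) := ⟨_, rfl⟩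
  have hcK0 : 0 ≤ cK := by rw [hcK]; exact K261_nonneg (by positivity) zero_le_one
  obtain ⟨C', hC'⟩ : ∃ C' : ℝ, C' = C ^ 2 * (((ℓ : ℝ) + 1) ^ 2 * cK) + 1 := ⟨_, rfl⟩
  have hC'pos : 0 < C' := by rw [hC']; positivity
  refine ⟨δ₀, C', M₀, max N₀ N₁, hδ₀, hC'pos, hM₀, lt_of_lt_of_le hN₀ (le_max_left _ _), ?_⟩
  intro k Mh R hMh hM hR hRM P hP hP4 D a c haw hcw hac y y'
  have hMh1 : 1 ≤ Mh := le_trans (by norm_num) hMh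
  have hRM0 : N₀ + 1 ≤ R * ((ℓ + 1) * Mh) := le_trans (Nat.succ_le_succ (le_max_left _ _)) hRM
  have hRM1 : N₁ + 1 ≤ R * ((ℓ + 1) * Mh) := le_trans (Nat.succ_le_succ (le_max_right _ _)) hRM
  have hRMone : 1 ≤ R * ((ℓ + 1) * Mh) := le_trans (by omega) hRM1
  -- the genuine torus (2.67)₁ majorant of `G′`
  have hmajD := hmaj k Mh R hMh hM hR hRM0 P hP hP4 D a c haw hcw hac
  -- Lemma 2.1 at `α = ¼` on the torus, (2.54), symmetry, (2.60)
  obtain ⟨-, h261, -, -⟩ := lemma21_torus D hMh1 hP hN₁pos hRM1 hδ₀.le (α := 1 / 4) (by norm_num) (by norm_num) hθlt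
  have h261B : Ineq261With cK (geomTB D) δ₀ (1 / 4) := by
    intro z; have := h261 z; rw [hcK]; exact this
  have htri := triangleTB D hMh1 hP
  have hsymm := symmTB D
  have hsep := levelSepTB D hMh1 hP hRMone
  have hRMnn := geomTB_RM_nonneg D hMh1 hRMone
  -- the threshold `L² ≤ e^{¼δ₀(RM − 1)}`
  have hthr : (geomTB D).L ^ 2 ≤ Real.exp (1 / 4 * δ₀ * (geomTB D).R * (geomTB D).M) := by
    have hprod : 1 / 4 * δ₀ * (geomTB D).R * (geomTB D).M = 1 / 4 * δ₀ * ((R : ℝ) * (((ℓ : ℝ) + 1) * Mh) - 1) := by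
      rw [mul_assoc (1 / 4 * δ₀), geomTB_RM D hMh1]
    rw [hprod, geomTB_L]
    have hge : (N₁ : ℝ) ≤ (R : ℝ) * (((ℓ : ℝ) + 1) * Mh) - 1 := by
      have : ((N₁ + 1 : ℕ) : ℝ) ≤ ((R * ((ℓ + 1) * Mh) : ℕ) : ℝ) := by exact_mod_cast hRM1
      push_cast at this; linarith
    have h2 : 2 * Real.log ((ℓ : ℝ) + 1) ≤ 1 / 4 * δ₀ * ((R : ℝ) * (((ℓ : ℝ) + 1) * Mh) - 1) := by
      have hd1 : (1 : ℝ) ≤ (d : ℝ) + 1 := by linarith [(Nat.cast_nonneg d : (0 : ℝ) ≤ d)]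
      nlinarith [mul_le_mul_of_nonneg_left hge (by positivity : (0 : ℝ) ≤ 1 / 4 * δ₀)]
    calc ((ℓ : ℝ) + 1) ^ 2 = Real.exp (2 * Real.log ((ℓ : ℝ) + 1)) := by
          rw [← Real.exp_log (pow_pos hL0 2), Real.log_pow]; norm_num
      _ ≤ _ := Real.exp_le_exp.2 h2
  -- (2.67)₁ on the torus in the operator form of `ineq268_of_267`
  have h267 : ∀ (b b' : (geomTB D).Site) (J : ↥(boxDom (N0 ℓ Mh k P)) → ℝ) (B : ℝ),
      (∀ x, J x ≠ 0 → blkOf D.toDomains x = b') → (∀ x, |J x| ≤ B) →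
      ∀ x, blkOf D.toDomains x = b → |Matrix.toLin' (gmlT (N0 ℓ Mh k P) ℓ k D.lev a) J x| ≤
        C * (geomTB D).len b ^ 2 * Real.exp (-(1 / 2 * δ₀ * (geomTB D).dist b b')) * B := by
    intro b b' J B hJ hB x hx
    have hB0 : 0 ≤ B := (abs_nonneg _).trans (hB x)
    have hBS : BlockSupp (g := geomT D) (blkOf D.toDomains) J b' B :=
      ⟨hB0, fun x' _ => hB x', fun x' hx' => by by_contra h; exact hx' (hJ x' h)⟩
    have h := hmajD b' J B hBS x
    rw [hx] at h
    have hK : C * ((ℓ : ℝ) + 1) ^ (2 * b.1.1) * Real.exp (-(δ₀ / 2 * (geomT D).dist b b')) =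
        C * (geomTB D).len b ^ 2 * Real.exp (-(1 / 2 * δ₀ * (geomTB D).dist b b')) := by
      rw [geomTB_len, geomTB_dist, mul_one, ← pow_mul, mul_comm b.1.1 2]
      congr 2; ring_nf
    rw [← hK]; exact h
  -- p01's kernel-checked (2.67)₁ ⟹ (2.68)
  have h268 := B6Ineq268From267.ineq268_of_267 (geomTB D) (d + 1)
    (Matrix.toLin' (gmlT (N0 ℓ Mh k P) ℓ k D.lev a)) (qB D.toDomains) (blkOf D.toDomains) (wX := 1) (C := C)
    (δ₀ := δ₀) (κ₁ := 1) (κ₂ := 1) (c := cK) one_pos (by rw [geomTB_eta]; exact one_pos) hC.le zero_le_one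
    (fun b x h => qB_ne_zero D.toDomains h) (sum_abs_qB_le D.toDomains) (fun b x => abs_qB_le_T D b x) h267 htri
    hsymm hsep (by rw [geomTB_L]; exact hL1) hRMnn hδ₀.le h261B hthr y y'
  -- bookkeeping: `X = kernelW W (Q′G′G′Q′*)` (the weight of the chain geometry is `W`), and the constants
  rw [lenTB_pow_eq_W] at h268
  have hX : |XkT D a y y'| ≤ 1 * 1 * C ^ 2 * ((geomTB D).L ^ 2 * cK) * (geomTB D).len y ^ 4 *
      ((geomTB D).len y' ^ (d + 1))⁻¹ * Real.exp (-(1 / 4 * δ₀ * (geomTB D).dist y y')) := h268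
  have hlen : ∀ z, (geomTB D).len z = (geomT D).len z := fun z => by rw [geomTB_len, geomT_len]
  have hleny : 0 < (geomT D).len y := lenT_pos D y
  have hleny' : 0 < (geomT D).len y' := lenT_pos D y'
  have hmain : |XkT D a y y'| ≤ C' * (geomT D).len y ^ 4 * ((geomT D).len y' ^ (d + 1))⁻¹ *
      Real.exp (-(δ₀ / 4 * (geomT D).dist y y')) := by
    refine hX.trans ?_
    rw [hlen, hlen, geomTB_dist, geomTB_L]
    have hrate : (1 : ℝ) / 4 * δ₀ * (geomT D).dist y y' = δ₀ / 4 * (geomT D).dist y y' := by ring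
    rw [hrate]
    have hrest : 0 ≤ (geomT D).len y ^ 4 * ((geomT D).len y' ^ (d + 1))⁻¹ *
        Real.exp (-(δ₀ / 4 * (geomT D).dist y y')) := by
      positivity
    have hc : 1 * 1 * C ^ 2 * (((ℓ : ℝ) + 1) ^ 2 * cK) ≤ C' := by rw [hC']; linarith
    calc 1 * 1 * C ^ 2 * (((ℓ : ℝ) + 1) ^ 2 * cK) * (geomT D).len y ^ 4 * ((geomT D).len y' ^ (d + 1))⁻¹ *
          Real.exp (-(δ₀ / 4 * (geomT D).dist y y'))
        = 1 * 1 * C ^ 2 * (((ℓ : ℝ) + 1) ^ 2 * cK) * ((geomT D).len y ^ 4 * ((geomT D).len y' ^ (d + 1))⁻¹ *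
          Real.exp (-(δ₀ / 4 * (geomT D).dist y y'))) := by ring
      _ ≤ C' * ((geomT D).len y ^ 4 * ((geomT D).len y' ^ (d + 1))⁻¹ * Real.exp (-(δ₀ / 4 * (geomT D).dist y y'))) :=
          mul_le_mul_of_nonneg_right hc hrest
      _ = _ := by ring
  refine ⟨hmain, ?_⟩
  -- the weighted form (hypothesis shape of the Prop. 2.3 kernels at the rate `½δ₀`)
  have hWpos : 0 < (geomT D).len y' ^ (d + 1) := pow_pos hleny' _
  rw [abs_mul, abs_of_pos hWpos]
  have hrate2 : (1 : ℝ) / 2 * (δ₀ / 2) * (geomT D).dist y y' = δ₀ / 4 * (geomT D).dist y y' := by ring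
  rw [hrate2]
  calc (geomT D).len y' ^ (d + 1) * |XkT D a y y'|
      ≤ (geomT D).len y' ^ (d + 1) * (C' * (geomT D).len y ^ 4 * ((geomT D).len y' ^ (d + 1))⁻¹ *
          Real.exp (-(δ₀ / 4 * (geomT D).dist y y'))) := mul_le_mul_of_nonneg_left hmain hWpos.le
    _ = C' * (geomT D).len y ^ 4 * Real.exp (-(δ₀ / 4 * (geomT D).dist y y')) := by
        field_simp

end Ineq268

end

end Literature.MathematicalPhysics.QuantumFieldTheory.Balaban1983to89.B6Ineq268MultiLevelTorusL0
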